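import Summits.ABC.ABC.Theses.CongruentialReceptacle
import Summits.ABC.ABC.Theorems.CongruentialReceptacleBalancedFreySzpiroStubFreyModelSqLe
import Literature.NumberTheory.EllipticCurves.SzpiroOfAbcProofs
import Literature.NumberTheory.EllipticCurves.DegreeConjectureAbc
import Literature.NumberTheory.DiophantineGeometry.MinimalDiscriminantNormProofs
import HarnessLib

/-!
# Crux `BalancedFreySzpiro` (stmt-ABC-1723) — the Szpiro trace port (line SketchIdeator1, glue)

The crux of route CongruentialReceptacle, `BalancedFreySzpiro` (Szpiro `6+ε` in elementary currency for
the Frey curves of κ-balanced abc triples), is DOWNSTREAM of every Szpiro-type statement of the summit.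
This file records the implications, all proved (the antecedents are the open statements):

* `szpiroMinimalModel_of_szpiroConjecture` — the line's hard stub `stub_szpiroMinimalModel`
  (`|Δ(W₀)| ≤ C · N^(6+ε)` for minimal integral models) follows from the Literature conjecture decl
  `SzpiroConjecture` (Silverman AEC VIII.11.1), by `|Δ_min| = |Δ(W₀)|`
  (`minimalDiscriminantNorm_eq_natAbs_holds`);
* `balancedFreySzpiro_of_szpiroConjecture` — `SzpiroConjecture → BalancedFreySzpiro`, through the landed
  stub `stub_freyModelSqLe` (global minimal Frey model with `N ∣ 2¹⁰ rad`, `(abc)² ≤ 2⁸|Δ|`); the balance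
  hypotheses are inert;
* `balancedFreySzpiro_of_abc` — `ABC → BalancedFreySzpiro` (the crux is not stronger than the summit),
  via the tree's `szpiro_of_abcLe_holds` (Silverman VIII.11.5(b));
* `balancedFreySzpiro_of_freyDegreeBound` — Frey's modular degree conjecture (the body of route
  DefiniteXi's `FreyDegreeBound`) implies the crux, relative to the two analytic named facts of
  `abcLt_of_freyDegreeBound` (Murty's Petersson lower bound, Silverman's covolume inequality).

So stmt-ABC-1723 closes automatically under any proof of `SzpiroConjecture`, of `ABC`, or of
`FreyDegreeBound` (+ the two facts) anywhere in the summit. Sources: Oesterlé 1988 §2–3; Silverman AEC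
VIII.11; Bombieri–Gubler Ex. 12.5.10, Thm. 12.5.12; Murty 1999 Thm. 1 via Pasten §3.
-/

set_option linter.dupNamespace false

noncomputable section

open UniqueFactorizationMonoid IsDedekindDomain Real WeierstrassCurve Rat.HeightOneSpectrum
open Literature.NumberTheory.EllipticCurves Literature.NumberTheory.DiophantineGeometry
open Summit.ABC.ABC.Theses.CongruentialReceptacle

namespace Summit.ABC.ABC.Theorems

/-- **The hard stub of line SketchIdeator1 follows from Szpiro's conjecture.** For minimal integral
models `W₀` (elliptic over `ℚ`, minimal at every prime) one has `|Δ_min(W₀/ℚ)| = |Δ(W₀)|`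
(`minimalDiscriminantNorm_eq_natAbs_holds`), so `SzpiroConjecture` gives
`|Δ(W₀)| ≤ C(ε) · N^(6+ε)`. (Conversely the stub gives `SzpiroConjecture` through global minimal models,
Néron 1964 / `hasGlobalMinimalModel_rat_holds`; not needed here.) [cite: SilvermanAEC2009, Conj. VIII.11.1] -/
theorem szpiroMinimalModel_of_szpiroConjecture (hS : SzpiroConjecture) :
    ∀ ε : ℝ, 0 < ε → ∃ C : ℝ, ∀ W₀ : WeierstrassCurve ℤ,
      (W₀.baseChange ℚ).IsElliptic → (∀ v : HeightOneSpectrum ℤ, (W₀.baseChange ℚ).IsMinimalAt v) →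
        (|W₀.Δ| : ℝ) ≤ C * (((W₀.baseChange ℚ).conductorNorm ℤ : ℕ) : ℝ) ^ (6 + ε) := by
  intro ε hε
  obtain ⟨C, hC⟩ := hS ε hε
  refine ⟨C, fun W₀ hE hmin ↦ ?_⟩
  haveI := hE
  have key := hC (W₀.baseChange ℚ)
  rw [minimalDiscriminantNorm_eq_natAbs_holds W₀ (Δ_ne_zero_of_isElliptic_baseChange_int W₀) hmin,
    Nat.cast_natAbs, Int.cast_abs] at key
  exact key

/-- **`SzpiroConjecture → BalancedFreySzpiro`.** Read Szpiro's inequality on the global minimal Frey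
model of the triple (`stub_freyModelSqLe`: `N ∣ 2¹⁰ rad(abc)`, `(abc)² ≤ 2⁸|Δ(W₀)|`):
`(abc)² ≤ 2⁸ C N^(6+ε) ≤ 2⁸ C 2^(10(6+ε)) rad^(6+ε)`. The balance hypotheses are not used.
[cite: Oesterle1988, §3] -/
theorem balancedFreySzpiro_of_szpiroConjecture : Literature.NumberTheory.EllipticCurves.SzpiroConjecture → Summit.ABC.ABC.Theses.CongruentialReceptacle.BalancedFreySzpiro := by
  intro hS
  unfold BalancedFreySzpiro
  intro κ _ ε hε
  obtain ⟨C₁, hC₁⟩ := szpiroMinimalModel_of_szpiroConjecture hS ε hε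
  set C : ℝ := max C₁ 1 with hCdef
  have hC0 : 0 ≤ C := zero_le_one.trans (le_max_right _ _)
  refine ⟨2 ^ 8 * C * ((2 : ℝ) ^ 10) ^ (6 + ε), fun a b c h _ _ ↦ ?_⟩
  obtain ⟨W₀, hE, hmin, hN, hsq⟩ := stub_freyModelSqLe a b c h
  have key := hC₁ W₀ hE hmin
  set N : ℝ := (((W₀.baseChange ℚ).conductorNorm ℤ : ℕ) : ℝ) with hNdef
  set R : ℝ := ((rad a b c : ℕ) : ℝ) with hRdef
  have hN0 : 0 ≤ N := by positivity
  have hR0 : 0 ≤ R := by positivity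
  have h1 : (|W₀.Δ| : ℝ) ≤ C * N ^ (6 + ε) :=
    key.trans (mul_le_mul_of_nonneg_right (le_max_left _ _) (by positivity))
  have h2 : N ≤ 2 ^ 10 * R := by
    have := Nat.le_of_dvd (mul_pos (by positivity) (by rw [rad_def]; exact Nat.radical_pos _)) hN
    rw [hNdef, hRdef]; exact_mod_cast this
  have hsq' : ((a * b * c : ℕ) : ℝ) ^ 2 ≤ 2 ^ 8 * (|W₀.Δ| : ℝ) := by
    have : (((a * b * c : ℕ) : ℤ) : ℝ) ^ 2 ≤ ((2 ^ 8 * |W₀.Δ| : ℤ) : ℝ) := by exact_mod_cast hsq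
    push_cast at this ⊢
    linarith
  calc ((a * b * c : ℕ) : ℝ) ^ 2 ≤ 2 ^ 8 * (|W₀.Δ| : ℝ) := hsq'
    _ ≤ 2 ^ 8 * (C * N ^ (6 + ε)) := by linarith
    _ ≤ 2 ^ 8 * (C * (2 ^ 10 * R) ^ (6 + ε)) := by gcongr
    _ = (2 ^ 8 * C * ((2 : ℝ) ^ 10) ^ (6 + ε)) * R ^ (6 + ε) := by
        rw [Real.mul_rpow (by positivity) hR0]; ring

/-- **`ABC → BalancedFreySzpiro`**: the crux is not stronger than the summit. `ABC` gives the `≤`-form of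
abc, hence `SzpiroConjecture` (`szpiro_of_abcLe_holds`, Silverman VIII.11.5(b) / B–G 12.5.12), hence the
crux. [cite: SilvermanAEC2009, VIII.11.5(b)] -/
theorem balancedFreySzpiro_of_abc (hABC : _root_.ABC) : BalancedFreySzpiro := by
  refine balancedFreySzpiro_of_szpiroConjecture (szpiro_of_abcLe_holds ?_)
  intro ε hε
  obtain ⟨C, _hC0, hC⟩ := hABC ε hε
  exact ⟨C, fun a b c h ↦ (hC a b c h).le⟩

/-- **Frey's degree conjecture implies the crux** (cross-link to route DefiniteXi): the hypothesis is
literally the body of `Summit.ABC.ABC.Theses.DefiniteXi.FreyDegreeBound` (`deg φ ≤ C · N^(2+ε)` for a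
modular parametrisation datum of every Frey curve); with the Petersson lower bound
(`ModularForms.murty_petersson_newform_lower_bound`) and Silverman's covolume inequality
(`ModularForms.silverman1986_discriminant_c4_covolume`) it gives `ABC` (`abcLt_of_freyDegreeBound`), hence the crux.
[cite: MurtyCongruencePrimes1999, Thm. 1 (degree conjecture implies abc) via PastenShimura2024 §3 Rem. 3.3] -/
theorem balancedFreySzpiro_of_freyDegreeBound
    (hP : ModularForms.murty_petersson_newform_lower_bound)
    (hS : ModularForms.silverman1986_discriminant_c4_covolume)
    (hdeg : ∀ ε : ℝ, 0 < ε → ∃ C : ℝ, ∀ a b : ℤ, IsCoprime a b → a * b * (a + b) ≠ 0 →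
      ∀ (N : ℕ) [NeZero N], (freyCurve a b).conductorNorm ℤ = N →
        ∃ D : ModularForms.ModularParametrizationData (freyCurve a b) N,
          (D.deg : ℝ) ≤ C * (N : ℝ) ^ (2 + ε)) :
    BalancedFreySzpiro :=
  balancedFreySzpiro_of_abc (abcLt_of_freyDegreeBound hP hS hdeg)

end Summit.ABC.ABC.Theorems

end
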